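/-
Origin: expansion seat `planner-pub-hodgecm-pv11-g9-0`, handover ONE rewrite: `^import Pv11g9\.` -> `import HodgeCM.PerL34.` (x1: `import Pv11g9.PrintedOrbitEndState` -> `import HodgeCM.PerL34.PrintedOrbitEndState`, my row #5 r30 49cb8416 v2); Mathlib import unchanged ; after HodgeCM/PerL34/PrintedOrbitEndState.lean (pv11-g9 #5); HOLD iff it is held (`HOME/pub-hodgecm-pv11-g9/lean/Pv11g9/PrintedSmoothEndState.lean`, md5 2fd0602c, 479 lines);
landed by the gen-8 packager in gate run 30 as `HodgeCM/PerL34/PrintedSmoothEndState.lean` (import ^import Pv11g9\.PrintedOrbitEndState[ \t]*$→import HodgeCM.PerL34.PrintedOrbitEndState ×1).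
-/
/-
Copyright: pub-hodgecm cell, unit pub-hodgecm-pv11-g9 (DAG-NODE PROVER #11, gen 9), node #6. Mathlib + tree only.
Origin / target: `HOME/pub-hodgecm-pv11-g9/lean/Pv11g9/PrintedSmoothEndState.lean` → `HodgeCM/PerL34/PrintedSmoothEndState.lean`
(imports this seat's node #5 `Pv11g9.PrintedOrbitEndState` → tree `HodgeCM.PerL34.PrintedOrbitEndState`, rewrite
`^import Pv11g9\.` ↦ `import HodgeCM.PerL34.`; plus one Mathlib calculus file).
-/
import Summits.HodgeConjecture.HodgeCM.PerL34.PrintedOrbitEndState_2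
import Mathlib.Analysis.Calculus.Deriv.Slope

/-!
# N29 on the END STATE with a 𝒯-FREE derivative field: `occ` from NINE fields about ω and 𝒮^κ alone

Node #5 (`PrintedOrbitEndState`) left, per good context and pair of a core with LINEAR Weil theta models, the nine
fields of `ArchC.LinOrbitSide`; eight of them speak only of the Weil representation side (the pure tensors `ins` and
their density in 𝒮^κ, the torus equivariance `omg_ins`, real directions `XR` spanning the printed ladder operators,
curves `e_j`), but the ninth, `hF`, is a statement about the THETA KERNEL: s ↦ 𝒯_{ω(e_j s)(φ⊗Φ_f)}(·)(g) has
operator-norm derivative 𝒯_{(X_jφ)⊗Φ_f}(·)(g) at 0.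

THIS LEAF replaces `hF` by pv06-g6's ω-ONLY field `smooth` ([SETUP D5′], the field of their RUN-30
`FockSmoothBridge` / `PrintedSmoothSide`, here on the END STATE): the difference quotients
s⁻¹(ω(e_j s)(φ⊗Φ_f) − ω(e_j 0)(φ⊗Φ_f)) converge IN THE TOPOLOGY OF 𝒮^κ to (X_jφ)⊗Φ_f — no 𝒯, no σ̂, no L².  KERNEL:
`hF` follows from `smooth`, the two linearity laws of Φ ↦ 𝒯_Φ and its operator-norm continuity (on the end state:
node #4 `TΦc_add_of_linear` / `TΦc_smul_of_linear` from pv02-g7's `LinearStr`, node #3 `continuous_TΦc`) by the chain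
rule through the continuous ℂ-linear map Φ ↦ 𝒯_Φ(·)(g) into the normed space of bounded functionals
(`hasDerivAt_linearMap_comp_of_tendsto_slope_zero`, Mathlib `hasDerivAt_iff_tendsto_slope`).

* §0 the chain rule (Mathlib only) and `pointFunctionalₗ` / `continuous_pointFunctional` /
  `hasDerivAt_pointFunctional_of_tendsto_slope` over the frozen interface.
* §1 (generic) `ArchC.LinSmoothSide C P RP kind lam hlam vac ιT [AddCommGroup SK] [Module ℂ SK]` — node #5's
  `LinOrbitSide` with `hF` replaced by `smooth`; `LinSmoothSide.toLinOrbit (TΦc_add) (TΦc_smul) (hTc)`, `.toOp`.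
* §2 (end state `T∘ := ThetaModel.ofRegCarrier (C.rtc R12 R34) hA`, under `[(C.wm V c).LinearStr]`) `LinSmoothCore12/34`,
  `toLinOrbit`, `H_occ`, **`Open_occ_of_linSmoothCores`**, `N29_occ_of_linSmoothCores`; §3 the same on prl1-g5's
  `C₀.thetaModel h d12 d34`; §4 `Assembly.perL_ofSignRecipe₀_linSmoothCores : … → U.PerL` (+ `COR_CM`).

PRINT WARRANT of `smooth` (referee adv2-g34 O14, accepted): Poulsen 1972 (J. Funct. Anal. 9,
doi:10.1016/0022-1236(72)90016-x) Prop. 1.2, p. 93 — for x ∈ D_∞ the orbit map g ↦ V_∞(g)x is C^∞ into D_∞ with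
Goodman's Fréchet topology — TOGETHER WITH the identification on 𝒮 of D_∞(ω_∞) and its topology with the Schwartz space
and topology — LOCATOR (referee adv2-g35 O14-R, GAPS l.9152, the warrant of record): (D_∞(μ|Mp), Goodman topology) =
(𝒮, Schwartz topology) by Folland 1989 p. 165 (dμ(𝒥) = πi(D²+X²), (4.47)) + Reed–Simon I, Appendix to §V.3, Lemmas 1–2 and
Thm. V.13 (pp. 141–143: the seminorms ‖(N+1)^m f‖₂ generate the Schwartz topology, ∩ D(N^m) = 𝒮) + Poulsen 1972 Thm. 1.2
p. 93 (D_∞ = ∩ D(Aⁿ) with the ‖Aⁿx‖-seminorms) + Folland Thm. (4.45) for the reverse inclusion; alternative locator named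
by pv12-g8 (GAPS pv12g8-1 (iii)–(iv)): Poulsen Example 5.1 p. 111, Corwin–Greenleaf 1990 Cor. 4.1.2 + App. A.1.  Folland
1989 Thm. (4.45) / Prop. (4.49) warrant only the VALUE dω(X_j) (L²-sense smooth vectors).  On the end state the topology of `T∘.SK V c = ↥(C.wm V c).SK` is WEIL's topology
on S(X_A) ([We64] n° 11), and `smooth` is, up to the harmless ℂ- vs ℝ-scalar form of the difference quotient, pv02-g7's
model-level `WeilThetaModel.HasSKDerivAt (fun s => ω(e_j s)Φ) ((X_jφ)⊗Φ_f) 0` (their RUN-30 `WeilThetaModelDeriv`, not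
imported here).

HONEST LABEL.  RESHAPING of one field (not implied by the old one: `smooth` is Schwartz-topology convergence, `hF` an
operator-norm derivative of the theta side; `smooth ⇒ hF` is the theorem here).  After it the END-STATE S4 input
consists of a kind map, scalings and NINE statements about (ω, 𝒮^κ, the printed Fock data) ALONE — the theta kernel,
σ̂, N21 and every continuity of 𝒯 have left the input.  Nothing archimedean is proved; no new constants, no `axiom`.
-/

set_option autoImplicit false

noncomputable section

open scoped Topology
open Filter MeasureTheory

namespace HodgeCM

namespace PerL34
namespace ArchC

open HodgeCM.Prior.Perl34File HodgeCM.Prior.Perl34File.Perl34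
open HodgeCM.PerL34.Fock HodgeCM.PerL34.Fock.PrintDict

/-! ## §0  The chain rule through a continuous linear map into a normed space -/

section Calculus

/-- **Chain rule, topological-vector-space source, normed target.**  If the difference quotients s⁻¹(γ s − γ 0)
(written with the complex scalar `((s : ℝ) : ℂ)⁻¹`) of a curve `γ` in a topological ℂ-module `S` converge to `γ'` as
s → 0, s ≠ 0, then for every CONTINUOUS ℂ-linear `T : S →ₗ[ℂ] E` into a normed ℂ-space the curve `T ∘ γ` has
derivative `T γ'` at 0.  Mathlib only (`hasDerivAt_iff_tendsto_slope`). -/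
theorem hasDerivAt_linearMap_comp_of_tendsto_slope_zero {S : Type*} [TopologicalSpace S] [AddCommGroup S]
    [Module ℂ S] {E : Type*} [NormedAddCommGroup E] [NormedSpace ℂ E] (T : S →ₗ[ℂ] E) (hT : Continuous T)
    {γ : ℝ → S} {γ' : S}
    (h : Tendsto (fun s : ℝ => ((s : ℝ) : ℂ)⁻¹ • (γ s - γ 0)) (𝓝[≠] 0) (𝓝 γ')) :
    HasDerivAt (fun s => T (γ s)) (T γ') 0 := by
  rw [hasDerivAt_iff_tendsto_slope]
  have h2 : Tendsto (fun s : ℝ => T (((s : ℝ) : ℂ)⁻¹ • (γ s - γ 0))) (𝓝[≠] 0) (𝓝 (T γ')) :=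
    (hT.tendsto γ').comp h
  refine h2.congr' (Eventually.of_forall fun s => ?_)
  simp only [slope_def_module, sub_zero, map_smul, map_sub]
  rw [← Complex.coe_smul, Complex.ofReal_inv]

variable {H HG CG G SK SigIdx SigIdxG : Type*}
variable [NormedAddCommGroup H] [InnerProductSpace ℂ H] [CompleteSpace H]
variable [NormedAddCommGroup HG] [InnerProductSpace ℂ HG] [CompleteSpace HG]
variable [NormedAddCommGroup CG] [NormedSpace ℂ CG]
variable [Group G] [TopologicalSpace G] [TopologicalSpace SK]
variable {C : IsolationCore H HG CG G SK SigIdx SigIdxG} {P : C4a.PointedCore C}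

/-- **Φ ↦ 𝒯_Φ(·)(g) as a ℂ-linear map into the bounded functionals on L²([U(W)])**, from the two linearity laws of
Φ ↦ 𝒯_Φ ([SETUP D4]; on the end state node #4's theorems). -/
def pointFunctionalₗ [AddCommGroup SK] [Module ℂ SK]
    (TΦc_add : ∀ Φ Ψ : SK, C.TΦc (Φ + Ψ) = C.TΦc Φ + C.TΦc Ψ)
    (TΦc_smul : ∀ (c : ℂ) (Φ : SK), C.TΦc (c • Φ) = c • C.TΦc Φ) (p : P.Pt) : SK →ₗ[ℂ] (H →L[ℂ] ℂ) where
  toFun Φ := C4a.pointFunctional C P Φ p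
  map_add' Φ Ψ := by
    show (P.evalPt p).comp (C.TΦc (Φ + Ψ)) = (P.evalPt p).comp (C.TΦc Φ) + (P.evalPt p).comp (C.TΦc Ψ)
    rw [TΦc_add, ContinuousLinearMap.comp_add]
  map_smul' c Φ := by
    show (P.evalPt p).comp (C.TΦc (c • Φ)) = c • (P.evalPt p).comp (C.TΦc Φ)
    rw [TΦc_smul, ContinuousLinearMap.comp_smul]

/-- (Ported verbatim from the HodgeCMPerL package; no docstring in the source.) -/
@[simp] theorem pointFunctionalₗ_apply [AddCommGroup SK] [Module ℂ SK]
    (TΦc_add : ∀ Φ Ψ : SK, C.TΦc (Φ + Ψ) = C.TΦc Φ + C.TΦc Ψ)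
    (TΦc_smul : ∀ (c : ℂ) (Φ : SK), C.TΦc (c • Φ) = c • C.TΦc Φ) (p : P.Pt) (Φ : SK) :
    pointFunctionalₗ TΦc_add TΦc_smul p Φ = C4a.pointFunctional C P Φ p := rfl

/-- Operator-norm continuity of Φ ↦ 𝒯_Φ (on the end state node #3 `continuous_TΦc`) gives continuity of
Φ ↦ 𝒯_Φ(·)(g) in operator norm. -/
theorem continuous_pointFunctional (hTc : Continuous fun Φ : SK => C.TΦc Φ) (p : P.Pt) :
    Continuous fun Φ : SK => C4a.pointFunctional C P Φ p :=
  continuous_const.clm_comp hTc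

/-- **`smooth ⇒ hF`, pointwise**: Schwartz-topology convergence of the difference quotients of a curve in 𝒮^κ gives
the operator-norm derivative of s ↦ 𝒯_{γ s}(·)(g). -/
theorem hasDerivAt_pointFunctional_of_tendsto_slope [AddCommGroup SK] [Module ℂ SK]
    (TΦc_add : ∀ Φ Ψ : SK, C.TΦc (Φ + Ψ) = C.TΦc Φ + C.TΦc Ψ)
    (TΦc_smul : ∀ (c : ℂ) (Φ : SK), C.TΦc (c • Φ) = c • C.TΦc Φ)
    (hTc : Continuous fun Φ : SK => C.TΦc Φ) {γ : ℝ → SK} {γ' : SK}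
    (h : Tendsto (fun s : ℝ => ((s : ℝ) : ℂ)⁻¹ • (γ s - γ 0)) (𝓝[≠] 0) (𝓝 γ')) (p : P.Pt) :
    HasDerivAt (fun s : ℝ => C4a.pointFunctional C P (γ s) p) (C4a.pointFunctional C P γ' p) 0 :=
  hasDerivAt_linearMap_comp_of_tendsto_slope_zero (pointFunctionalₗ TΦc_add TΦc_smul p)
    (continuous_pointFunctional hTc p) h

end Calculus

/-! ## §1  The 𝒯-free linear side (generic) -/

section Smooth

variable {H HG CG G SK SigIdx SigIdxG : Type*}
variable [NormedAddCommGroup H] [InnerProductSpace ℂ H] [CompleteSpace H]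
variable [NormedAddCommGroup HG] [InnerProductSpace ℂ HG] [CompleteSpace HG]
variable [NormedAddCommGroup CG] [NormedSpace ℂ CG]
variable [Group G] [TopologicalSpace G] [TopologicalSpace SK]

/-- **The 𝒯-free D7-free LINEAR printed side**: node #5's `LinOrbitSide` with the theta-side derivative `hF` replaced by
pv06-g6's ω-side `smooth`.  NINE fields over a ℂ-vector-space structure on `𝒮^κ` given as instance parameters; every
field speaks of (ω, 𝒮^κ, the printed Fock data) only. -/
structure LinSmoothSide (C : IsolationCore H HG CG G SK SigIdx SigIdxG) (P : C4a.PointedCore C)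
    (RP : Type) [Fintype RP] [DecidableEq RP] (kind : RP → PlaceKind) (lam : RP → ℂ)
    (hlam : ∀ b, lam b ≠ 0) (vac : RP → (Circle × Circle →* Circle))
    (ιT : (printPlaces RP kind lam hlam vac).Tg →* G) [AddCommGroup SK] [Module ℂ SK] where
  /-- [SETUP D4] index of the fixed data at the other places: Φ_f ∈ 𝒮((V₃⊗W)(𝔸_f)). -/
  FinIdx : Type
  /-- [SETUP D4] the pure tensor φ ↦ φ ⊗ Φ_f ∈ 𝒮^κ, linear in φ. -/
  ins : FinIdx → (printPlaces RP kind lam hlam vac).F →ₗ[ℂ] SK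
  /-- [SETUP D4/D5] the pure tensors span a dense subspace of 𝒮^κ. -/
  dense : Dense (Submodule.span ℂ
    (Set.range fun q : FinIdx × (printPlaces RP kind lam hlam vac).F => ins q.1 q.2) : Set SK)
  /-- [SETUP D4] ω(t)(φ ⊗ Φ_f) = (ω_∞(t)φ) ⊗ Φ_f (printed scalings, PINNED vacuum characters). -/
  omg_ins : ∀ (f : FinIdx) (t : (printPlaces RP kind lam hlam vac).Tg) (φ : (printPlaces RP kind lam hlam vac).F),
    C.omg (ιT t) (ins f φ) = ins f ((printPlaces RP kind lam hlam vac).ωT t φ)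
  /-- [SETUP D5] index of a family of REAL directions X_j ∈ 𝔲(W)(L₀⊗ℝ). -/
  ιR : Type
  /-- [SETUP D5] ω_∞(X_j) on 𝓕^κ_∞ (VALUE: Folland 1989 Thm. (4.45) / Prop. (4.49)). -/
  XR : ιR → (printPlaces RP kind lam hlam vac).F →ₗ[ℂ] (printPlaces RP kind lam hlam vac).F
  /-- [SETUP D4] the curves e_j : ℝ → U(W)(𝔸) (intended exp(sX_j)). -/
  e : ιR → ℝ → G
  /-- [SETUP D5] every printed slot / ladder operator is a ℂ-combination of the real directions. -/
  ladder_span : ∀ k : (printPlaces RP kind lam hlam vac).ιX,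
    (printPlaces RP kind lam hlam vac).X k ∈ Submodule.span ℂ (Set.range XR)
  /-- [SETUP D5′, FRÉCHET-SMOOTH VECTOR — ω alone: no 𝒯, no σ̂, no L²] φ⊗Φ_f is a C¹ vector of ω along e_j with
  derivative (X_jφ)⊗Φ_f IN THE TOPOLOGY OF 𝒮^κ: s⁻¹(ω(e_j s)(φ⊗Φ_f) − ω(e_j 0)(φ⊗Φ_f)) → (X_jφ)⊗Φ_f as s → 0, s ≠ 0.
  PRINT WARRANT: Poulsen 1972 Prop. 1.2, p. 93 (orbit maps of D_∞-vectors are C^∞ into D_∞, Goodman's Fréchet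
  topology) + the identification of (D_∞(ω_∞), its topology) on 𝒮 with the Schwartz space and topology (adv2g34-O14;
  LOCATOR adv2g35-O14-R: Folland 1989 p. 165 + Reed–Simon I App. to §V.3 Lemmas 1–2 / Thm. V.13 pp. 141–143 + Poulsen
  Thm. 1.2 p. 93 + Folland Thm. (4.45); alternative pv12g8-1 (iii)–(iv): Poulsen Ex. 5.1 p. 111, Corwin–Greenleaf
  Cor. 4.1.2 + App. A.1); Folland (4.45)/(4.49) for the VALUE dω(X_j) only. -/
  smooth : ∀ (j : ιR) (f : FinIdx) (φ : (printPlaces RP kind lam hlam vac).F),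
    Tendsto (fun s : ℝ => ((s : ℝ) : ℂ)⁻¹ • (C.omg (e j s) (ins f φ) - C.omg (e j 0) (ins f φ)))
      (𝓝[≠] 0) (𝓝 (ins f (XR j φ)))

namespace LinSmoothSide

variable [AddCommGroup SK] [Module ℂ SK] {C : IsolationCore H HG CG G SK SigIdx SigIdxG} {P : C4a.PointedCore C}
variable {RP : Type} [Fintype RP] [DecidableEq RP] {kind : RP → PlaceKind} {lam : RP → ℂ} {hlam : ∀ b, lam b ≠ 0}
  {vac : RP → (Circle × Circle →* Circle)} {ιT : (printPlaces RP kind lam hlam vac).Tg →* G}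

/-- **`smooth ⇒ hF`**: node #5's nine-field `LinOrbitSide` from the 𝒯-free one plus the two linearity laws and the
operator-norm continuity of Φ ↦ 𝒯_Φ (§0 `hasDerivAt_pointFunctional_of_tendsto_slope`); eight fields verbatim. -/
def toLinOrbit (A : LinSmoothSide C P RP kind lam hlam vac ιT)
    (TΦc_add : ∀ Φ Ψ : SK, C.TΦc (Φ + Ψ) = C.TΦc Φ + C.TΦc Ψ)
    (TΦc_smul : ∀ (c : ℂ) (Φ : SK), C.TΦc (c • Φ) = c • C.TΦc Φ)
    (hTc : Continuous fun Φ : SK => C.TΦc Φ) : LinOrbitSide C P RP kind lam hlam vac ιT where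
  FinIdx := A.FinIdx
  ins := A.ins
  dense := A.dense
  omg_ins := A.omg_ins
  ιR := A.ιR
  XR := A.XR
  e := A.e
  ladder_span := A.ladder_span
  hF := fun j f φ p => hasDerivAt_pointFunctional_of_tendsto_slope TΦc_add TΦc_smul hTc (A.smooth j f φ) p

/-- Read-back (`rfl`): the pure tensors of the derived side ARE `ins`. -/
theorem toLinOrbit_ins (A : LinSmoothSide C P RP kind lam hlam vac ιT)
    (TΦc_add : ∀ Φ Ψ : SK, C.TΦc (Φ + Ψ) = C.TΦc Φ + C.TΦc Ψ)
    (TΦc_smul : ∀ (c : ℂ) (Φ : SK), C.TΦc (c • Φ) = c • C.TΦc Φ)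
    (hTc : Continuous fun Φ : SK => C.TΦc Φ) : (A.toLinOrbit TΦc_add TΦc_smul hTc).ins = A.ins := rfl

/-- … and node #5's eleven-field operator side. -/
def toOp (A : LinSmoothSide C P RP kind lam hlam vac ιT)
    (TΦc_add : ∀ Φ Ψ : SK, C.TΦc (Φ + Ψ) = C.TΦc Φ + C.TΦc Ψ)
    (TΦc_smul : ∀ (c : ℂ) (Φ : SK), C.TΦc (c • Φ) = c • C.TΦc Φ)
    (hTc : Continuous fun Φ : SK => C.TΦc Φ) : OpOrbitSide C P RP kind lam hlam vac ιT :=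
  (A.toLinOrbit TΦc_add TΦc_smul hTc).toOp TΦc_add TΦc_smul hTc

/-- **Detected ⊆ Eigen for the printed torus from the 𝒯-free side** (plus the linearity laws, operator-norm
continuity and N21). -/
theorem eigen_of_detected (A : LinSmoothSide C P RP kind lam hlam vac ιT)
    (TΦc_add : ∀ Φ Ψ : SK, C.TΦc (Φ + Ψ) = C.TΦc Φ + C.TΦc Ψ)
    (TΦc_smul : ∀ (c : ℂ) (Φ : SK), C.TΦc (c • Φ) = c • C.TΦc Φ)
    (hTc : Continuous fun Φ : SK => C.TΦc Φ)
    (hinv : ∀ (h : G) (Φ : SK) (v : H), C.TΦc (C.omg h Φ) (C.R h v) = C.TΦc Φ v)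
    (Φ : SK) (i : SigIdx) (h : ∃ v ∈ C.hatσ i, C.TΦ Φ v ≠ 0) :
    ∃ y ∈ C.hatσ i, y ≠ 0 ∧ ∀ t : (printPlaces RP kind lam hlam vac).Tg,
      C.R (ιT t) y = printPlacesW RP kind lam hlam vac t • y :=
  (A.toOp TΦc_add TΦc_smul hTc).eigen_of_detected hinv Φ i h

end LinSmoothSide

end Smooth

end ArchC
end PerL34

/-! ## §2  On the END STATE: `Open_occ` from 𝒯-free linear cores -/

namespace Universe

namespace AdelicTorusCore

open HodgeCM.PerL34 HodgeCM.PerL34.ArchC HodgeCM.PerL34.Fock HodgeCM.PerL34.Fock.PrintDict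
open HodgeCM.Prior.Perl34File HodgeCM.Prior.Perl34File.Perl34
open NumberField NumberField.SeesawArchTorus

variable {U : Universe} {hP : PrintFact_unitaryCompact} (C : U.AdelicTorusCore hP)
  (R12 : ∀ {L : CMField} {ι₁ : L →+* ℂ} (V : HermSpace3 L ι₁) (c : SeesawCtx L), C.Rest12 V c)
  (R34 : ∀ {L : CMField} {ι₁ : L →+* ℂ} (V : HermSpace3 L ι₁) (c : SeesawCtx L), C.Rest34 V c)
  (hA : (C.rtc R12 R34).Analytic)

section OpenOcc

/-- **The (12) 𝒯-free LINEAR printed core of a context on the END STATE of a linear Weil theta model**: a kind map,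
scalings, and a nine-field `LinSmoothSide` over `T∘.core V c` at the canonical points and the canonical (12) chart —
`smooth` is convergence in WEIL's topology on `T∘.SK V c = ↥(C.wm V c).SK`. -/
structure LinSmoothCore12 {L : CMField} {ι₁ : L →+* ℂ} (V : HermSpace3 L ι₁) (c : SeesawCtx L)
    [ℓ : (C.wm V c).LinearStr] where
  /-- decidable equality of the infinite places (any instance; used only to form the printed places) -/
  [decEq : DecidableEq (InfinitePlace (L : Type))]
  /-- the kind `Σ₁₂ / D₁₂ / ι₁` of each infinite place -/
  kind : InfinitePlace (L : Type) → PlaceKind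
  /-- the printed scalings `λ_b ≠ 0` -/
  lam : InfinitePlace (L : Type) → ℂ
  hlam : ∀ w, lam w ≠ 0
  /-- the 𝒯-free linear side at the canonical points and the canonical (12) chart -/
  side : LinSmoothSide ((ThetaModel.ofRegCarrier (C.rtc R12 R34) hA).core V c) (C.pointedCore R12 R34 hA V c)
    (InfinitePlace (L : Type)) kind lam hlam (pinnedVacs kind (R12 V c).m₁ (R12 V c).m₂)
    (C.chart12 R12 V c kind lam hlam)

/-- **The (34) 𝒯-free LINEAR printed core of a context on the END STATE of a linear Weil theta model.** -/
structure LinSmoothCore34 {L : CMField} {ι₁ : L →+* ℂ} (V : HermSpace3 L ι₁) (c : SeesawCtx L)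
    [ℓ : (C.wm V c).LinearStr] where
  [decEq : DecidableEq (InfinitePlace (L : Type))]
  kind : InfinitePlace (L : Type) → PlaceKind
  lam : InfinitePlace (L : Type) → ℂ
  hlam : ∀ w, lam w ≠ 0
  side : LinSmoothSide ((ThetaModel.ofRegCarrier (C.rtc R12 R34) hA).core V c) (C.pointedCore R12 R34 hA V c)
    (InfinitePlace (L : Type)) kind lam hlam (pinnedVacs kind (R34 V c).m₁ (R34 V c).m₂)
    (C.chart34 R34 V c kind lam hlam)

namespace LinSmoothCore12

variable {C R12 R34 hA} {L : CMField} {ι₁ : L →+* ℂ} {V : HermSpace3 L ι₁} {c : SeesawCtx L}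

/-- Node #5's nine-field linear core from the 𝒯-free one: linearity laws := node #4 `TΦc_add_of_linear` /
`TΦc_smul_of_linear`, operator-norm continuity := node #3 `continuous_TΦc`. -/
def toLinOrbit [ℓ : (C.wm V c).LinearStr] (A : LinSmoothCore12 C R12 R34 hA V c) :
    LinOrbitCore12 C R12 R34 hA V c :=
  letI := A.decEq
  { decEq := A.decEq
    kind := A.kind
    lam := A.lam
    hlam := A.hlam
    side := A.side.toLinOrbit (C.TΦc_add_of_linear R12 R34 hA V c) (C.TΦc_smul_of_linear R12 R34 hA V c)
      (C.continuous_TΦc R12 R34 hA V c) }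

/-- **Lemma 4.1(c), pair (12), on the END STATE of a linear Weil theta model from the nine 𝒯-free fields alone**;
conclusion literally `(T∘.t12 V c).wOccurs i`. -/
theorem H_occ [ℓ : (C.wm V c).LinearStr] (A : LinSmoothCore12 C R12 R34 hA V c) :
    ∀ (Φ : (ThetaModel.ofRegCarrier (C.rtc R12 R34) hA).SK V c)
      (i : (ThetaModel.ofRegCarrier (C.rtc R12 R34) hA).SigIdx V c),
      (∃ v ∈ ((ThetaModel.ofRegCarrier (C.rtc R12 R34) hA).core V c).hatσ i,
        ((ThetaModel.ofRegCarrier (C.rtc R12 R34) hA).core V c).TΦ Φ v ≠ 0) →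
      ((ThetaModel.ofRegCarrier (C.rtc R12 R34) hA).t12 V c).wOccurs i :=
  A.toLinOrbit.H_occ

end LinSmoothCore12

namespace LinSmoothCore34

variable {C R12 R34 hA} {L : CMField} {ι₁ : L →+* ℂ} {V : HermSpace3 L ι₁} {c : SeesawCtx L}

/-- The (34) nine-field linear core from the 𝒯-free one. -/
def toLinOrbit [ℓ : (C.wm V c).LinearStr] (A : LinSmoothCore34 C R12 R34 hA V c) :
    LinOrbitCore34 C R12 R34 hA V c :=
  letI := A.decEq
  { decEq := A.decEq
    kind := A.kind
    lam := A.lam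
    hlam := A.hlam
    side := A.side.toLinOrbit (C.TΦc_add_of_linear R12 R34 hA V c) (C.TΦc_smul_of_linear R12 R34 hA V c)
      (C.continuous_TΦc R12 R34 hA V c) }

/-- **Lemma 4.1(c), pair (34), on the END STATE of a linear Weil theta model from the nine 𝒯-free fields alone.** -/
theorem H_occ [ℓ : (C.wm V c).LinearStr] (A : LinSmoothCore34 C R12 R34 hA V c) :
    ∀ (Φ : (ThetaModel.ofRegCarrier (C.rtc R12 R34) hA).SK V c)
      (i : (ThetaModel.ofRegCarrier (C.rtc R12 R34) hA).SigIdx V c),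
      (∃ v ∈ ((ThetaModel.ofRegCarrier (C.rtc R12 R34) hA).core V c).hatσ i,
        ((ThetaModel.ofRegCarrier (C.rtc R12 R34) hA).core V c).TΦ Φ v ≠ 0) →
      ((ThetaModel.ofRegCarrier (C.rtc R12 R34) hA).t34 V c).wOccurs i :=
  A.toLinOrbit.H_occ

end LinSmoothCore34

/-- **`Open_occ` (N29 = PerL Lemma 4.1(c) / Thm 3.7 (†), BOTH torus sides) of the END-STATE theta model of a core with
LINEAR Weil theta models, from nine 𝒯-FREE fields per good context and pair** (kind + scalings + `LinSmoothSide`).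
No hypothesis mentions the theta kernel, σ̂, N21 or a continuity of Φ ↦ 𝒯_Φ. -/
theorem Open_occ_of_linSmoothCores
    (lin : ∀ {L : CMField} {ι₁ : L →+* ℂ} (V : HermSpace3 L ι₁) (c : SeesawCtx L), (C.wm V c).LinearStr)
    (A12 : ∀ {L : CMField} {ι₁ : L →+* ℂ} (V : HermSpace3 L ι₁) (c : SeesawCtx L),
      (ThetaModel.ofRegCarrier (C.rtc R12 R34) hA).GoodCtx ι₁ c →
        Nonempty (C.LinSmoothCore12 R12 R34 hA V c (ℓ := lin V c)))
    (A34 : ∀ {L : CMField} {ι₁ : L →+* ℂ} (V : HermSpace3 L ι₁) (c : SeesawCtx L),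
      (ThetaModel.ofRegCarrier (C.rtc R12 R34) hA).GoodCtx ι₁ c →
        Nonempty (C.LinSmoothCore34 R12 R34 hA V c (ℓ := lin V c))) :
    (ThetaModel.ofRegCarrier (C.rtc R12 R34) hA).Open_occ :=
  fun V c hc => ⟨fun Φ i h => (A12 V c hc).elim fun A => A.H_occ (ℓ := lin V c) Φ i h,
    fun Φ i h => (A34 V c hc).elim fun A => A.H_occ (ℓ := lin V c) Φ i h⟩

/-- **N29 BY THE CARVER'S NAME** (`Arch.N29_occ`) on the end state, from the 𝒯-free linear cores. -/
theorem N29_occ_of_linSmoothCores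
    (lin : ∀ {L : CMField} {ι₁ : L →+* ℂ} (V : HermSpace3 L ι₁) (c : SeesawCtx L), (C.wm V c).LinearStr)
    (A12 : ∀ {L : CMField} {ι₁ : L →+* ℂ} (V : HermSpace3 L ι₁) (c : SeesawCtx L),
      (ThetaModel.ofRegCarrier (C.rtc R12 R34) hA).GoodCtx ι₁ c →
        Nonempty (C.LinSmoothCore12 R12 R34 hA V c (ℓ := lin V c)))
    (A34 : ∀ {L : CMField} {ι₁ : L →+* ℂ} (V : HermSpace3 L ι₁) (c : SeesawCtx L),
      (ThetaModel.ofRegCarrier (C.rtc R12 R34) hA).GoodCtx ι₁ c →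
        Nonempty (C.LinSmoothCore34 R12 R34 hA V c (ℓ := lin V c))) :
    N29_occ (ThetaModel.ofRegCarrier (C.rtc R12 R34) hA) :=
  C.Open_occ_of_linSmoothCores R12 R34 hA lin A12 A34

end OpenOcc

end AdelicTorusCore

/-! ## §3  The same for the sign-recipe end state `C₀.thetaModel h d12 d34` (prl1-g5) -/

namespace AdelicThetaCore

open HodgeCM.PerL34

variable {U : Universe} {hP : PrintFact_unitaryCompact} (C₀ : U.AdelicThetaCore hP) (h : Bool)
  (d12 d34 : ∀ {L : CMField}, SeesawCtx L → SideData L)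


-- port_pkg: scope closed for this part
end AdelicThetaCore
end Universe
end HodgeCM
end
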